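import Literature.NumberTheory.Automorphic.KTypeGrowthOfHarishChandraMultiplicity   -- ★ p830845 (A-p06 (g24)): N5 + KF2 currency (`subRep`, `restrict_mem_harishChandraSpace`)
import Literature.RepresentationTheory.IntertwiningMapExhaustion                    -- ★ p831059 (A-p06 (g24)): N4a exhaustion
import Literature.RepresentationTheory.IntertwiningMapFiltrationTelescope           -- ★ p831104 (A-p06 (g24)): N4b telescope over orthogonal complements
import HarnessLib

/-!
# `K`-multiplicities of the Harish-Chandra module from a bound along a finite-dimensional `K`-stable filtration (the N4 GLUE)

Topic `NumberTheory/Automorphic`; namespace `Literature.NumberTheory.Automorphic`; THEOREMS ONLY (no `def`, no named fact, no instance, no notation,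
no `sorry`).  Cell `hodgecm-mathlib`, F0∕P3, T1a arch line: the GLUE of the counting node N4 of the in-house road to the letter V19 ★
`IrreducibleUnitaryKTypeGrowth` (skeleton draft `F0/P3/Lines-draft/T1a_V19_KTypeGrowthPaydown.A-p06g24.lean`): it turns a per-level multiplicity bound
along ANY exhaustive monotone chain `F` of finite-dimensional `K`-stable subspaces of `H_K^∞` (N1 supplies the `𝔭`-filtration, N2+N3 the per-level bound)
into the hypothesis `hd` of ★ `kTypeGrowth_of_harishChandraMultiplicity` (N5), in KF2's `subRep` currency.

THE STATEMENT ([KnappVogan1995, §I.3]; [Varadarajan1989, §5.4, proof of Thm. 19]).  Let `ϖ` be a UNITARY representation of `G` on the Hilbert space `E`,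
`K` its maximal compact subgroup acting on the Harish-Chandra space `H_K^∞` by ★ `harishChandraRepK` — by ISOMETRIES of the pre-Hilbert structure
inherited from `E` (§1).  Let `F : ℕ → Subrepresentation (harishChandraRepK G ϖ)` be monotone, finite-dimensional at each level, and exhaustive.  Along
`F` the orthogonal complements `Q (m+1) = F (m+1) ⊓ (F m)ᗮ` are `K`-stable (★ N4b), and if for a finite-dimensional `τ`
`dim Hom_K(τ, F 0) + Σ_{m<n} dim Hom_K(τ, Q (m+1)) ≤ B` for all `n` (for every such complement system `Q`), then `Hom_K(τ, H_K^∞)` is finite-dimensional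
with `dim ≤ B` (★ N4a), read in the `subRep` currency of KF2 ★ p828868 (§2: `harishChandraRepK = (ϖ|_K).subRep H_K^∞` definitionally, and
`Hom_K(τ, ⊤) ↪ Hom_K(τ, H_K^∞)` is onto).
HONEST LABEL: closes no registered stub by itself (the skeleton's `stub_multBound` = this glue ∘ N1 ∘ (N2+N3)).  HC_CM is proved only modulo the 2 remaining
named inputs (hLiu418, h413) until rung 0 closes.

## References
* A. W. Knapp, D. A. Vogan, *Cohomological Induction and Unitary Representations* (1995), §I.3 [KnappVogan1995].
* V. S. Varadarajan, *An Introduction to Harmonic Analysis on Semisimple Lie Groups* (1989), §5.4 (proof of Thm. 19) [Varadarajan1989].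
-/

set_option autoImplicit false

noncomputable section

namespace Literature.NumberTheory.Automorphic

open Literature.RepresentationTheory
open scoped InnerProductSpace

variable {N : Type*} [Fintype N] [DecidableEq N] (G : RealMatrixGroup ℂ N)
  {E : Type} [NormedAddCommGroup E] [InnerProductSpace ℂ E] [CompleteSpace E] {ϖ : ContRepresentation ℂ G.carrier E}

/-! ## §1 `K` acts on `H_K^∞` by isometries; `harishChandraRepK` in the `subRep` currency -/

/-- For a unitary `ϖ`, `K` acts on the pre-Hilbert space `H_K^∞ ⊆ E` by isometries: `⟪k·v, k·w⟫ = ⟪v, w⟫`. [cite: KnappVogan1995, §I.3] -/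
theorem harishChandraRepK_inner_map_map (hu : ϖ.IsUnitary) (k : G.maximalCompact) (v w : harishChandraSpace G ϖ) :
    ⟪harishChandraRepK G ϖ k v, harishChandraRepK G ϖ k w⟫_ℂ = ⟪v, w⟫_ℂ := by
  rw [Submodule.coe_inner, Submodule.coe_inner, coe_harishChandraRepK_apply, coe_harishChandraRepK_apply]
  exact ContinuousLinearMap.inner_map_map_of_mem_unitary (hu _) _ _

omit [CompleteSpace E] in
/-- ★ `harishChandraRepK` IS KF2's `(ϖ|_K).subRep H_K^∞` (definitionally). [folklore] [cite: KnappVogan1995, §I.3] -/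
theorem harishChandraRepK_eq_subRep :
    harishChandraRepK G ϖ =
      (ϖ.restrict (Subgroup.inclusion G.maximalCompact_le_carrier)).subRep (harishChandraSpace G ϖ) G.restrict_mem_harishChandraSpace :=
  rfl

/-! ## §2 `Hom_K(τ, ⊤)` versus `Hom_K(τ, V)` -/

section Top

variable {k : Type*} [Field k] {K : Type*} [Monoid K] {X : Type*} [AddCommGroup X] [Module k X] {W : Type*} [AddCommGroup W] [Module k W]
  (τ : Representation k K W) (ρ : Representation k K X)

/-- Corestriction to `⊤`: `Hom_K(τ, ρ)` embeds into `Hom_K(τ, ⊤.toRepresentation)`, so finiteness and a dimension bound descend from `⊤` to `ρ`.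
[cite: KnappVogan1995, §I.3] -/
theorem finite_and_finrank_intertwiningMap_le_of_top {B : ℕ}
    (h : Module.Finite k (Representation.IntertwiningMap τ (⊤ : Subrepresentation ρ).toRepresentation) ∧
      Module.finrank k (Representation.IntertwiningMap τ (⊤ : Subrepresentation ρ).toRepresentation) ≤ B) :
    Module.Finite k (Representation.IntertwiningMap τ ρ) ∧ Module.finrank k (Representation.IntertwiningMap τ ρ) ≤ B := by
  obtain ⟨hfin, hB⟩ := h
  haveI := hfin
  -- the corestriction `f ↦ (w ↦ ⟨f w, trivial⟩)`
  let cor : Representation.IntertwiningMap τ ρ →ₗ[k] Representation.IntertwiningMap τ (⊤ : Subrepresentation ρ).toRepresentation :=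
    { toFun := fun f =>
        { toLinearMap := LinearMap.codRestrict ((⊤ : Subrepresentation ρ).toSubmodule) f.toLinearMap fun _ => trivial
          isIntertwining' := fun g => by
            apply LinearMap.ext
            intro w
            apply Subtype.ext
            exact LinearMap.congr_fun (f.isIntertwining' g) w }
      map_add' := fun f f' => by
        apply Representation.IntertwiningMap.ext; apply LinearMap.ext; intro w; rfl
      map_smul' := fun c f => by
        apply Representation.IntertwiningMap.ext; apply LinearMap.ext; intro w; rfl }
  have hinj : Function.Injective cor := by
    intro f f' hff'
    apply Representation.IntertwiningMap.ext; apply LinearMap.ext; intro w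
    have h1 := congrArg (fun T : Representation.IntertwiningMap τ (⊤ : Subrepresentation ρ).toRepresentation => ((T w : (⊤ : Subrepresentation ρ).toSubmodule) : X)) hff'
    exact h1
  exact ⟨Module.Finite.of_injective cor hinj, (LinearMap.finrank_le_finrank_of_injective hinj).trans hB⟩

end Top

/-! ## §3 The glue: per-level bounds along an exhaustive finite-dimensional `K`-stable chain bound `dim Hom_K(τ, H_K^∞)` -/

/-- **N4 GLUE.**  `ϖ` unitary; `F` a monotone, levelwise finite-dimensional, exhaustive chain of `K`-stable subspaces of `H_K^∞`; `τ` finite-dimensional.  If for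
EVERY system of `K`-stable complements `Q` with `F (m+1) = F m ⊔ Q (m+1)`, `F m ⊓ Q (m+1) = ⊥`, `Q (m+1) = F (m+1) ⊓ (F m)ᗮ`, `Q 0 = F 0` one has
`dim Hom_K(τ, F 0) + Σ_{m<n} dim Hom_K(τ, Q (m+1)) ≤ B` for all `n`, then `Hom_K(τ, H_K^∞)` (KF2's `subRep` currency) is finite-dimensional of dimension `≤ B`.
(`W : Type`, the universe of `E` and of the letter V19's `K`-types: ★ N4a∕N4b are stated with source and target in one universe.)
[cite: KnappVogan1995, §I.3] [cite: Varadarajan1989, §5.4 (proof of Thm. 19)] -/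
theorem finite_and_finrank_intertwiningMap_harishChandra_le_of_filtration (hu : ϖ.IsUnitary)
    (F : ℕ → Subrepresentation (harishChandraRepK G ϖ)) (hmono : ∀ m, F m ≤ F (m + 1)) [∀ m, FiniteDimensional ℂ (F m).toSubmodule]
    (hex : ∀ v : harishChandraSpace G ϖ, ∃ n, v ∈ (F n).toSubmodule)
    {W : Type} [AddCommGroup W] [Module ℂ W] [FiniteDimensional ℂ W] (τ : Representation ℂ G.maximalCompact W) {B : ℕ}
    (hlev : ∀ Q : ℕ → Subrepresentation (harishChandraRepK G ϖ),
      (∀ m, F (m + 1) = F m ⊔ Q (m + 1)) → (∀ m, Disjoint (F m).toSubmodule (Q (m + 1)).toSubmodule) →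
      (∀ m, (Q (m + 1)).toSubmodule = (F (m + 1)).toSubmodule ⊓ (F m).toSubmoduleᗮ) → Q 0 = F 0 →
      ∀ n, Module.finrank ℂ (Representation.IntertwiningMap τ (F 0).toRepresentation) +
        ∑ m ∈ Finset.range n, Module.finrank ℂ (Representation.IntertwiningMap τ (Q (m + 1)).toRepresentation) ≤ B) :
    FiniteDimensional ℂ (τ.IntertwiningMap
        ((ϖ.restrict (Subgroup.inclusion G.maximalCompact_le_carrier)).subRep (harishChandraSpace G ϖ) G.restrict_mem_harishChandraSpace)) ∧
      Module.finrank ℂ (τ.IntertwiningMap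
        ((ϖ.restrict (Subgroup.inclusion G.maximalCompact_le_carrier)).subRep (harishChandraSpace G ϖ) G.restrict_mem_harishChandraSpace)) ≤ B := by
  classical
  -- §1: isometric action, so orthogonal complements along the chain are `K`-stable (N4b)
  have hσ := harishChandraRepK_inner_map_map G hu
  obtain ⟨Q', hsup', hdisj', hQ'⟩ := exists_compl_chain_of_isometry hσ F hmono
  -- normalise level `0`
  let Q : ℕ → Subrepresentation (harishChandraRepK G ϖ) := fun m => if m = 0 then F 0 else Q' m
  have hQs : ∀ m, Q (m + 1) = Q' (m + 1) := fun m => if_neg (Nat.succ_ne_zero m)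
  have hQ0 : Q 0 = F 0 := if_pos rfl
  have hsup : ∀ m, F (m + 1) = F m ⊔ Q (m + 1) := fun m => by rw [hQs]; exact hsup' m
  have hdisj : ∀ m, Disjoint (F m).toSubmodule (Q (m + 1)).toSubmodule := fun m => by rw [hQs]; exact hdisj' m
  have hQ : ∀ m, (Q (m + 1)).toSubmodule = (F (m + 1)).toSubmodule ⊓ (F m).toSubmoduleᗮ := fun m => by rw [hQs]; exact hQ' m
  -- N4b: the telescope gives `dim Hom_K(τ, F n) ≤ B` for every `n`
  have hFn : ∀ n, Module.finrank ℂ (Representation.IntertwiningMap τ (F n).toRepresentation) ≤ B := fun n => by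
    rw [finrank_intertwiningMap_eq_add_sum_orthogonal τ F Q hsup hdisj hQ hQ0 n]
    exact hlev Q hsup hdisj hQ hQ0 n
  -- N4a: exhaustion
  have hmono' : Monotone fun n => (F n).toSubmodule := monotone_nat_of_le_succ fun n => hmono n
  have htop := finite_and_finrank_intertwiningMap_le_of_monotone_exhaustion τ (⊤ : Subrepresentation (harishChandraRepK G ϖ)) F hmono'
    (fun v _ => hex v) hFn
  -- read in the `subRep` currency
  have h := finite_and_finrank_intertwiningMap_le_of_top τ (harishChandraRepK G ϖ) htop
  rw [harishChandraRepK_eq_subRep G] at h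
  exact ⟨h.1, h.2⟩

end Literature.NumberTheory.Automorphic

end
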